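import Summits.CriticalPhenomena.CardyFormulaZ2.Theorems.CardySusyWardDiscretisationFamilyExistsLegStd
import Summits.CriticalPhenomena.CardyFormulaZ2.Theorems.CardySusyWardDiscretisationFamilyExistsLegAxis
import Literature.Probability.LatticeModels.MeshDomainJordan
import Literature.Probability.RandomPlanarGeometry.ChordalCurveFamily
import HarnessLib

/-!
# The leg near a frontier point of a Jordan domain, for all small meshes — helper for `DiscretisationFamilyExists` (stmt-CriticalPhenomena-9644)

`eventually_legData`: for a Jordan domain `J`, a frontier point `a` and a window radius `η > 0`
there is a deep point `p` (with a disc about it inside the domain, inside `ball a (η/4)`) such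
that for all small `δ > 0` some point `p₁` within `3δ` of `p` carries leg data
`LegData J.carrier δ a η p₁`.  Proof: an axis-aligned interior/exterior pair near `a`
(`exists_aligned_pair`), the quarter turn putting it in standard position (uniformly in `δ`:
`exists_standard_iso'`), the bulk lemma for the largest component in the turned domain
(`JordanDomain.eventually_forall_mem_meshDomain'`), the standard-position leg (`legData_std`) and
the pull-back along the quarter turn (`nonempty_legData_of_image`).
-/

noncomputable section

open Set Metric Complex Filter
open Literature.Probability.LatticeModels Literature.Probability.Percolation
  Literature.Probability.LatticeModels.Mesh Literature.Probability.LatticeModels.DiscreteDobrushin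
  Literature.Probability.RandomPlanarGeometry Literature.Topology.PlaneTopology

namespace Summit.CriticalPhenomena.CardyFormulaZ2.Theorems.DiscretisationFamilyExists

/-- Mesh compatibility of a coordinate map `g x = (s xᵢ, t xⱼ)` with the multiplication `z ↦ c z`,
for every mesh, from the case `δ = 1`. [folklore] -/
theorem meshPoint_map_of_formula {g : Site 2 ≃ Site 2} {G : ℂ ≃ₗᵢ[ℝ] ℂ} {c : ℂ} {s t : ℤ} {i j : Fin 2}
    (hG : ∀ z, G z = c * z) (hg : ∀ x, g x = ![s * x i, t * x j])
    (hre : ∀ x : Site 2, (c * meshPoint 1 x).re = s * x i) (him : ∀ x : Site 2, (c * meshPoint 1 x).im = t * x j)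
    (δ : ℝ) (x : Site 2) : meshPoint δ (g x) = G (meshPoint δ x) := by
  have hsc : meshPoint δ x = (δ : ℂ) * meshPoint 1 x := by
    apply Complex.ext <;> simp [meshPoint_re, meshPoint_im]
  have e1 : G (meshPoint δ x) = (δ : ℂ) * (c * meshPoint 1 x) := by rw [hG, hsc]; ring
  rw [e1, hg]
  apply Complex.ext
  · rw [meshPoint_re, Complex.re_ofReal_mul, hre]; simp
  · rw [meshPoint_im, Complex.im_ofReal_mul, him]; simp

/-- **Standard orientation, uniformly in the mesh.** As `exists_standard_iso`, with the mesh
compatibility for every `δ`. [folklore] -/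
theorem exists_standard_iso' {p q : ℂ} (hpq : p ≠ q) (hal : p.re = q.re ∨ p.im = q.im) :
    ∃ (g gf : Site 2 ≃ Site 2) (G : ℂ ≃ₗᵢ[ℝ] ℂ) (π : Fin 4 → Fin 4),
      (∀ (δ : ℝ) (x : Site 2), meshPoint δ (g x) = G (meshPoint δ x)) ∧
      (∀ x f, IsCorner (g x) (gf f) ↔ IsCorner x f) ∧
      (∀ x m, g.symm (x + cornerUnit m) = g.symm x + cornerUnit (π m)) ∧
      (∀ m, cornerUnit (π (m + 1)) = cornerUnit (π m + 1) ∨ cornerUnit (π (m + 1)) = -cornerUnit (π m + 1)) ∧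
      (G q).re = (G p).re ∧ (G q).im < (G p).im := by
  have hne : p.re ≠ q.re ∨ p.im ≠ q.im := by
    by_contra h; push Not at h; exact hpq (Complex.ext h.1 h.2)
  rcases hal with h | h
  · have him : p.im ≠ q.im := by rcases hne with h' | h'; exact absurd h h'; exact h'
    rcases lt_or_gt_of_ne him with hlt | hlt
    · obtain ⟨g, gf, G, π, -, h2, h3, h4, hG, hg, -⟩ := exists_latticeIso_neg 1
      refine ⟨g, gf, G, π, meshPoint_map_of_formula (c := -1) (s := -1) (t := -1) (i := 0) (j := 1)
        (fun z => by rw [hG]; ring) (fun x => by rw [hg]; simp) (fun x => by simp [meshPoint_re])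
        (fun x => by simp [meshPoint_im]), h2, h3, h4, by rw [hG, hG]; simp [h], by rw [hG, hG]; simp; linarith⟩
    · exact ⟨Equiv.refl _, Equiv.refl _, LinearIsometryEquiv.refl ℝ ℂ, id, fun _ _ => rfl, fun _ _ => Iff.rfl,
        fun _ _ => rfl, fun _ => Or.inl rfl, h.symm, hlt⟩
  · have hre : p.re ≠ q.re := by rcases hne with h' | h'; exact h'; exact absurd h h'
    rcases lt_or_gt_of_ne hre with hlt | hlt
    · obtain ⟨g, gf, G, π, -, h2, h3, h4, hG, hg, -⟩ := exists_latticeIso_rotNegI 1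
      refine ⟨g, gf, G, π, meshPoint_map_of_formula (c := -I) (s := 1) (t := -1) (i := 1) (j := 0)
        hG (fun x => by rw [hg]; simp) (fun x => by simp [meshPoint_re, meshPoint_im])
        (fun x => by simp [meshPoint_re, meshPoint_im]), h2, h3, h4, ?_, ?_⟩ <;> rw [hG, hG] <;> simp [h]; linarith
    · obtain ⟨g, gf, G, π, -, h2, h3, h4, hG, hg, -⟩ := exists_latticeIso_rotI 1
      refine ⟨g, gf, G, π, meshPoint_map_of_formula (c := I) (s := -1) (t := 1) (i := 1) (j := 0)
        hG (fun x => by rw [hg]; simp) (fun x => by simp [meshPoint_re, meshPoint_im])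
        (fun x => by simp [meshPoint_re, meshPoint_im]), h2, h3, h4, ?_, ?_⟩ <;> rw [hG, hG] <;> simp [h]; linarith

set_option maxHeartbeats 800000 in
/-- **The leg near a frontier point, for all small meshes.** See the module docstring.
[folklore] -/
theorem eventually_legData (J : JordanDomain) {a : ℂ} (ha : a ∈ frontier J.carrier) {η : ℝ} (hη : 0 < η) :
    ∃ (p : ℂ) (ρ : ℝ), 0 < ρ ∧ ball p ρ ⊆ J.carrier ∧ p ∈ ball a (η / 4) ∧
      ∀ᶠ δ in nhdsWithin (0 : ℝ) (Set.Ioi 0),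
        ∃ p₁ : ℂ, dist p₁ p ≤ 3 * δ ∧ Nonempty (LegData J.carrier δ a η p₁) := by
  obtain ⟨hΩ, hext, hunb, hJE⟩ := regular_of_eq_carrier (D := ⟨J.carrier, 1, ∅, ∅⟩) J rfl
  dsimp only at hΩ hext hunb hJE
  obtain ⟨p, q, hp, hq, hpb, hqb, hal⟩ := exists_aligned_pair hΩ hJE ha (ρ := η / 8) (by positivity)
  have hpq : p ≠ q := fun h => hq (h ▸ subset_closure hp)
  obtain ⟨g, gf, G, π, hG, hcor, hunit, hπ, hre, hlt⟩ := exists_standard_iso' hpq hal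
  -- radii
  obtain ⟨rp, hrp, hbp⟩ := Metric.isOpen_iff.1 hΩ p hp
  obtain ⟨rq, hrq, hbq⟩ := Metric.isOpen_iff.1 isClosed_closure.isOpen_compl q hq
  -- the turned domain
  set J' := J.map G.toHomeomorph with hJ'
  have hcar : J'.carrier = G '' J.carrier := rfl
  have hK : closedBall (G p) (rp / 2) ⊆ J'.carrier := by
    rw [hcar, ← LinearIsometryEquiv.image_closedBall]
    exact image_mono ((closedBall_subset_ball (by linarith)).trans hbp)
  have hbulk := J'.eventually_forall_mem_meshDomain' (isCompact_closedBall _ _) hK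
  -- the scale
  have hgap : 0 < (G p).im - (G q).im := by linarith
  have hdpq : dist p q < η / 4 := by
    have := dist_triangle p a q
    rw [mem_ball] at hpb hqb; rw [dist_comm] at hqb; linarith
  set δ₀ : ℝ := min (min (rp / 24) (rq / 4)) (min (((G p).im - (G q).im) / 7) (η / 32)) with hδ₀
  have hδ₀pos : 0 < δ₀ := by positivity
  refine ⟨p, rp, hrp, hbp, (ball_subset_ball (by linarith)) hpb, ?_⟩
  filter_upwards [hbulk, Ioo_mem_nhdsGT hδ₀pos] with δ hbulkδ hδ
  obtain ⟨hδ0, hδ1⟩ := hδ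
  have h1 : δ ≤ rp / 24 := hδ1.le.trans ((min_le_left _ _).trans (min_le_left _ _))
  have h2 : δ ≤ rq / 4 := hδ1.le.trans ((min_le_left _ _).trans (min_le_right _ _))
  have h3 : δ ≤ ((G p).im - (G q).im) / 7 := hδ1.le.trans ((min_le_right _ _).trans (min_le_left _ _))
  have h4 : δ ≤ η / 32 := hδ1.le.trans ((min_le_right _ _).trans (min_le_right _ _))
  -- the hypotheses of the standard-position leg in the turned domain
  have hq' : ball (G q) rq ⊆ (closure (G '' J.carrier))ᶜ := by
    rw [compl_closure_image, ← LinearIsometryEquiv.image_ball]; exact image_mono hbq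
  have hp' : ball (G p) (12 * δ) ⊆ G '' J.carrier := by
    rw [← LinearIsometryEquiv.image_ball]; exact image_mono ((ball_subset_ball (by linarith)).trans hbp)
  have hb' : ∀ x : Site 2, meshPoint δ x ∈ closedBall (G p) (12 * δ) → x ∈ meshDomain (G '' J.carrier) δ := by
    intro x hx
    have := hbulkδ.1 x (closedBall_subset_closedBall (by linarith) hx)
    rwa [hcar] at this
  have hw' : closedBall (G p) (dist (G p) (G q) + 16 * δ) ⊆ ball (G a) η := by
    rw [G.dist_map]
    intro z hz
    rw [mem_closedBall] at hz
    rw [mem_ball]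
    have := dist_triangle z (G p) (G a)
    rw [G.dist_map] at this
    rw [mem_ball] at hpb
    linarith
  obtain ⟨p₁, hp₁, hL⟩ := legData_std (G.toHomeomorph.isOpenMap _ hΩ) (frontier_image_subset G hJE)
    (isConnected_compl_closure_image G hext) (not_isBounded_compl_closure_image G hunb)
    (frontier_image_nonempty G ⟨a, ha⟩) hδ0 hq' (by linarith) hp' hb' hre (by linarith) hw'
  refine ⟨G.symm p₁, by rw [← G.symm.dist_map p₁ (G p), G.symm_apply_apply] at hp₁; exact hp₁, ?_⟩
  refine nonempty_legData_of_image (Ω := J.carrier) hδ0 (hG δ) hcor hunit hπ ?_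
  rw [LinearIsometryEquiv.apply_symm_apply]; exact hL

end Summit.CriticalPhenomena.CardyFormulaZ2.Theorems.DiscretisationFamilyExists

end
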